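import Mathlib
import HarnessLib
import Summits.ValiantsHypothesis.ValiantsHypothesis.Theses.MonotoneRestoration
import Literature.Computability.AlgebraicComplexity.ArithCircuit
import Literature.Computability.AlgebraicComplexity.ArithCircuitProofs
import Literature.Computability.AlgebraicComplexity.MonotoneStructure
import Literature.Computability.AlgebraicComplexity.PermanentIrreducible
import Literature.ModelTheory.FiniteModelTheory.CkEquiv
import Summits.ValiantsHypothesis.ValiantsHypothesis.Theorems.MonotoneRestorationMonotoneRestorationQPCosetCount
import Summits.ValiantsHypothesis.ValiantsHypothesis.Theorems.MonotoneRestorationMonotoneRestorationQPSymmetricLB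
import Summits.ValiantsHypothesis.ValiantsHypothesis.Theorems.MonotoneRestorationMonotoneRestorationQPSupportSymmetrisation
import Summits.ValiantsHypothesis.ValiantsHypothesis.Theorems.MonotoneRestorationMonotoneRestorationQPSparseRegime
import Summits.ValiantsHypothesis.ValiantsHypothesis.Theorems.MonotoneRestorationMonotoneRestorationQPBeta
import Literature.Computability.AlgebraicComplexity.SymmetricArithCircuit
import Literature.Computability.AlgebraicComplexity.DawarWilsenach2025Proofs
import Literature.GroupTheory.PermutationGroups.SmallIndexSubgroups
import Summits.ValiantsHypothesis.ValiantsHypothesis.Theorems.MonotoneRestorationQP.Negative.LoadBearing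
import Summits.ValiantsHypothesis.ValiantsHypothesis.Theorems.MonotoneRestorationMonotoneRestorationQPPermSupportCount

/-! TTRL-lite variant V19144 of stmt-ValiantsHypothesis-15886 -/

namespace Summit.ValiantsHypothesis.ValiantsHypothesis.Theorems

open Summit.ValiantsHypothesis.ValiantsHypothesis.Theses.MonotoneRestoration
open Literature.Computability.AlgebraicComplexity

/-- TTRL-lite variant V19144 of `stub_esymmRowSums_structure` (stmt-ValiantsHypothesis-15886):
above the threshold `k > n` there is no `k`-subset of the `n` rows, so the elementary symmetric
polynomial `esymm (Fin n) NNReal k` is already `0` (`Finset.powersetCard_eq_empty`), hence so is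
its substitution by the row sums. Together with the nonvanishing for `k ≤ n` this shows `k ≤ n`
is exactly the nonvanishing threshold. -/
theorem stub_esymmRowSums_structure_var19144 :
    ∀ (n k : ℕ), n < k → MvPolynomial.bind₁ (fun i : Fin n => ∑ j : Fin n, MvPolynomial.X (i, j))
      (MvPolynomial.esymm (Fin n) NNReal k) = 0 := by
  intro n k hnk
  have h : MvPolynomial.esymm (Fin n) NNReal k = 0 := by
    rw [MvPolynomial.esymm, Finset.powersetCard_eq_empty.2 (by simpa using hnk), Finset.sum_empty]
  rw [h, map_zero]

end Summit.ValiantsHypothesis.ValiantsHypothesis.Theorems
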